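import Summits.CriticalPhenomena.PercolationContinuityZ3.Theorems.PercNearOneGluingNoHeavyQuantIndepBlobFar
import HarnessLib

/-!
# QUANT lane R8, independent blobs in the RELIABLE regime (all gates `≥ 1/2`): the half-MASS small-ball inequality —
# the far-relay row for block stars needs only MASS `> 2j`, not budget `> 2j`

builds on p205010 (kernel theorem, internal audit signed; external expert review pending)

Support file (`--supports stmt-CriticalPhenomena-4575`), QUANT lane census seat prim-quant-census-1 (gen 14), rung R8 of
`run/shared/lean/prim/quant/LADDER.md`; memo `run/shared/lean/prim/quant/prim-quant-census-1/TREES-G14.md` §2.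

Setting of `…QuantIndepBlobFar.lean`: a finite type `ι` of blobs, gates `p i ∈ [p₀, 1]`, weights `a i ≥ 0`, product-Bernoulli weight
`∏_k (p k | 1 − p k)` of the set `W` of open gates, count `X W = ∑_{i∈W} a i`.  The Hall–Harris transport of that file
(`IndepBlob.exists_injective_heavy_superset` + `IndepBlob.weight_transport`) is stated there at the half-MEAN threshold; its proof uses the
mean only through `m ≤ ∑ a`.  This file records the MASS form, which is strictly stronger in the reliable regime:

* `IndepBlob.transport_of_half_le_gate` — gates `≥ p₀ ≥ 1/2`, reals `λ ≤ η` with `λ + η ≤ ∑ a`: `p₀·P(X < λ) ≤ (1 − p₀)·P(X ≥ η)`.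
* `IndepBlob.halfMass_smallBall` — `P(X < (∑ a)/2) ≤ 1 − p₀`; conditioned form `halfMass_smallBall_cond` with a distinguished blob `(a₀, p₀)`:
  `p₀·P(X + a₀ < t) + (1 − p₀)·P(X < t) ≤ 1 − p₀`, `t = (a₀ + ∑ a)/2` (the remark in the docstring of `halfMean_smallBall_of_half_le_gate`).
* `IndepBlob.massRow` / `massRow_cond` — **layer form: if every gate is `≥ p₀ ≥ 1/2` and `2j < ∑ a` (total MASS above `2j`; for integer
  weights: mass `≥ 2j+1`) then `P(X ≤ j) ≤ 1 − p₀`** — the far-relay row `Quant.FarRelayRow` for block stars with the budget hypothesis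
  `2j < ∑ a·p` replaced by the mass hypothesis.  (For `p₀ < 1/2` the budget is needed: two blobs of size `j` at gate `p₀` have mass `2j`
  … three units at gate `0.4`, `j = 1`: mass `3 > 2`, `P(X ≤ 1) = 0.648 > 0.6`.)

CONTRAST (census, exact rationals, memo §2): the mass form is FALSE ON TREES even for least marginal `≥ 1/2` — root blob `(2, 77/144)` plus a
gated 3-star (gate `7/12`, three unit leaves at `11/12`): least marginal `x = 77/144 > 1/2`, mass `5`, `j = 2`, `P(N ≤ 2) = 0.4792 > 1 − x = 0.4653`
(budget `2.67 < 4`, so `Quant.FarTreeRow` is untouched).  On trees the budget hypothesis of FAR is therefore essential in the reliable regime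
too; for independent blobs it is not.  Use (census-2 g49 ARCH-TREES-G49 §2.4): in the two-point-term architecture every term made of a sure
part `s` and HEAVY blobs only is certified at floor `x ≥ 1/2` as soon as its mass exceeds `2(j − s)`.
[cite: KozmaNitzan2024, Conjecture 3 (p. 15)] (the gluing rows served); Harris–Kleitman / Hall as in `…QuantIndepBlobFar.lean`;
the mass form is [this work].  Theorems only, no sorries, standard axioms.
-/

namespace Summit.CriticalPhenomena.PercolationContinuityZ3.Theorems

namespace Quant

namespace IndepBlob

open Finset

variable {ι : Type*} [Fintype ι] [DecidableEq ι]

/-- **Hall–Harris transport, mass form.**  Gates `p₀ ≤ p i ≤ 1` with `p₀ ≥ 1/2`, weights `a i ≥ 0`, reals `λ ≤ η` with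
`λ + η ≤ ∑ a` (and `p₀ ≤ 1`).  Then `p₀ · P(X < λ) ≤ (1 − p₀) · P(X ≥ η)` (`X W = ∑_{i∈W} a i`): the light sets inject into heavy strict
supersets (`exists_injective_heavy_superset`; strictness from `λ ≤ η`) and each step gains the factor `p₀/(1 − p₀)`
(`weight_transport`). [this work] -/
theorem transport_of_half_le_gate (p a : ι → ℝ) (p₀ lam eta : ℝ) (hhalf : 1 / 2 ≤ p₀) (hp₀1 : p₀ ≤ 1)
    (hp : ∀ i, p₀ ≤ p i) (hp1 : ∀ i, p i ≤ 1) (ha : ∀ i, 0 ≤ a i) (hle : lam ≤ eta) (hsum : lam + eta ≤ ∑ i, a i) :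
    p₀ * (∑ W ∈ (Finset.univ : Finset (Finset ι)).filter (fun W => ∑ i ∈ W, a i < lam),
        (∏ k, if k ∈ W then p k else 1 - p k)) ≤
      (1 - p₀) * (∑ V ∈ (Finset.univ : Finset (Finset ι)).filter (fun V => ¬ (∑ i ∈ V, a i < eta)),
        (∏ k, if k ∈ V then p k else 1 - p k)) := by
  have hp₀ : 0 ≤ p₀ := by linarith
  have hf0 : 0 ≤ 1 - p₀ := by linarith
  have hw0 : ∀ W, 0 ≤ (∏ k, if k ∈ W then p k else 1 - p k) := bernoulliWeight_nonneg (fun i => hp₀.trans (hp i)) hp1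
  obtain ⟨φ, hφinj, hφ⟩ := exists_injective_heavy_superset a ha lam eta hsum
  -- the light sum, re-indexed by the subtype
  have hLeq : ∑ W ∈ (Finset.univ : Finset (Finset ι)).filter (fun W => ∑ i ∈ W, a i < lam), (∏ k, if k ∈ W then p k else 1 - p k) =
      ∑ W : {W : Finset ι // ∑ i ∈ W, a i < lam}, (∏ k, if k ∈ (W : Finset ι) then p k else 1 - p k) := by
    refine Finset.sum_subtype _ (fun W => ?_) _
    rw [Finset.mem_filter]
    exact ⟨fun hW => hW.2, fun hW => ⟨Finset.mem_univ _, hW⟩⟩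
  -- transport term by term
  have hstep : ∀ W : {W : Finset ι // ∑ i ∈ W, a i < lam},
      p₀ * (∏ k, if k ∈ (W : Finset ι) then p k else 1 - p k) ≤ (1 - p₀) * (∏ k, if k ∈ φ W then p k else 1 - p k) := by
    intro W
    refine weight_transport hhalf hp hp1 (hφ W).1 fun hWφ => ?_
    have h1 : eta ≤ ∑ i ∈ φ W, a i := (hφ W).2
    have h2 : ∑ i ∈ (W : Finset ι), a i < lam := W.2
    rw [← hWφ] at h1
    linarith
  have hsum' : p₀ * ∑ W : {W : Finset ι // ∑ i ∈ W, a i < lam}, (∏ k, if k ∈ (W : Finset ι) then p k else 1 - p k) ≤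
      (1 - p₀) * ∑ W : {W : Finset ι // ∑ i ∈ W, a i < lam}, (∏ k, if k ∈ φ W then p k else 1 - p k) := by
    rw [Finset.mul_sum, Finset.mul_sum]
    exact Finset.sum_le_sum fun W _ => hstep W
  -- the image of `φ` lies in the heavy sets
  have himage : ∑ W : {W : Finset ι // ∑ i ∈ W, a i < lam}, (∏ k, if k ∈ φ W then p k else 1 - p k) ≤
      ∑ V ∈ (Finset.univ : Finset (Finset ι)).filter (fun V => ¬ (∑ i ∈ V, a i < eta)), (∏ k, if k ∈ V then p k else 1 - p k) := by
    rw [← Finset.sum_image (f := fun V : Finset ι => ∏ k, if k ∈ V then p k else 1 - p k) (s := Finset.univ) (g := φ)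
      fun x _ y _ hxy => hφinj hxy]
    refine Finset.sum_le_sum_of_subset_of_nonneg (fun V hV => ?_) fun V _ _ => hw0 V
    rw [Finset.mem_image] at hV
    obtain ⟨W, -, rfl⟩ := hV
    rw [Finset.mem_filter]
    exact ⟨Finset.mem_univ _, not_lt.2 (hφ W).2⟩
  rw [hLeq]
  exact hsum'.trans (mul_le_mul_of_nonneg_left himage hf0)

/-- **Half-mass small-ball inequality, conditioned form.**  Gates `p₀ ≤ p i ≤ 1`, `1/2 ≤ p₀ ≤ 1`, weights `a i ≥ 0`, a
distinguished blob `(a₀, p₀)` with `a₀ ≥ 0`, and `t = (a₀ + ∑ a)/2` (half the total MASS).  Then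
`p₀ · P(X + a₀ < t) + (1 − p₀) · P(X < t) ≤ 1 − p₀` — the mass version of `halfMean_smallBall_of_half_le_gate`
(thresholds `λ = t − a₀ ≤ η = t`, `λ + η = ∑ a`). [this work] -/
theorem halfMass_smallBall_cond (p a : ι → ℝ) (p₀ a₀ : ℝ) (hhalf : 1 / 2 ≤ p₀) (hp₀1 : p₀ ≤ 1)
    (hp : ∀ i, p₀ ≤ p i) (hp1 : ∀ i, p i ≤ 1) (ha : ∀ i, 0 ≤ a i) (ha₀ : 0 ≤ a₀) :
    p₀ * (∑ W ∈ (Finset.univ : Finset (Finset ι)).filter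
        (fun W => ∑ i ∈ W, a i + a₀ < (a₀ + ∑ i, a i) / 2), (∏ k, if k ∈ W then p k else 1 - p k)) +
      (1 - p₀) * (∑ W ∈ (Finset.univ : Finset (Finset ι)).filter
        (fun W => ∑ i ∈ W, a i < (a₀ + ∑ i, a i) / 2), (∏ k, if k ∈ W then p k else 1 - p k)) ≤ 1 - p₀ := by
  set t : ℝ := (a₀ + ∑ i, a i) / 2 with ht
  have hf0 : 0 ≤ 1 - p₀ := by linarith
  have hle : t - a₀ ≤ t := by linarith
  have hsum : (t - a₀) + t ≤ ∑ i, a i := by rw [ht]; linarith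
  have htr := transport_of_half_le_gate p a p₀ (t - a₀) t hhalf hp₀1 hp hp1 ha hle hsum
  have hLeq : ∑ W ∈ (Finset.univ : Finset (Finset ι)).filter (fun W => ∑ i ∈ W, a i + a₀ < t), (∏ k, if k ∈ W then p k else 1 - p k) =
      ∑ W ∈ (Finset.univ : Finset (Finset ι)).filter (fun W => ∑ i ∈ W, a i < t - a₀), (∏ k, if k ∈ W then p k else 1 - p k) := by
    refine Finset.sum_congr ?_ fun _ _ => rfl
    ext W
    simp only [Finset.mem_filter, Finset.mem_univ, true_and]
    constructor <;> intro h <;> linarith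
  have htot : ∑ V ∈ (Finset.univ : Finset (Finset ι)).filter (fun V => ∑ i ∈ V, a i < t), (∏ k, if k ∈ V then p k else 1 - p k) +
      ∑ V ∈ (Finset.univ : Finset (Finset ι)).filter (fun V => ¬ (∑ i ∈ V, a i < t)), (∏ k, if k ∈ V then p k else 1 - p k) = 1 := by
    rw [Finset.sum_filter_add_sum_filter_not, sum_bernoulliWeight]
  rw [hLeq]
  calc p₀ * ∑ W ∈ (Finset.univ : Finset (Finset ι)).filter (fun W => ∑ i ∈ W, a i < t - a₀), (∏ k, if k ∈ W then p k else 1 - p k) +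
        (1 - p₀) * ∑ W ∈ (Finset.univ : Finset (Finset ι)).filter (fun W => ∑ i ∈ W, a i < t), (∏ k, if k ∈ W then p k else 1 - p k)
      ≤ (1 - p₀) * ∑ V ∈ (Finset.univ : Finset (Finset ι)).filter (fun V => ¬ (∑ i ∈ V, a i < t)), (∏ k, if k ∈ V then p k else 1 - p k) +
        (1 - p₀) * ∑ W ∈ (Finset.univ : Finset (Finset ι)).filter (fun W => ∑ i ∈ W, a i < t), (∏ k, if k ∈ W then p k else 1 - p k) := by
          linarith
    _ = 1 - p₀ := by rw [← mul_add, add_comm, htot, mul_one]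

/-- **Half-mass small-ball inequality.**  If every gate satisfies `1/2 ≤ p₀ ≤ p i ≤ 1` and the weights are nonnegative, then
`P(X < (∑ a)/2) ≤ 1 − p₀`: with probability at least the least gate, at least half of the total MASS is open. [this work] -/
theorem halfMass_smallBall (p a : ι → ℝ) (p₀ : ℝ) (hhalf : 1 / 2 ≤ p₀) (hp₀1 : p₀ ≤ 1)
    (hp : ∀ i, p₀ ≤ p i) (hp1 : ∀ i, p i ≤ 1) (ha : ∀ i, 0 ≤ a i) :
    ∑ W ∈ (Finset.univ : Finset (Finset ι)).filter (fun W => ∑ i ∈ W, a i < (∑ i, a i) / 2),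
        (∏ k, if k ∈ W then p k else 1 - p k) ≤ 1 - p₀ := by
  set t : ℝ := (∑ i, a i) / 2 with ht
  have htr := transport_of_half_le_gate p a p₀ t t hhalf hp₀1 hp hp1 ha le_rfl (by rw [ht]; linarith)
  have htot : ∑ V ∈ (Finset.univ : Finset (Finset ι)).filter (fun V => ∑ i ∈ V, a i < t), (∏ k, if k ∈ V then p k else 1 - p k) +
      ∑ V ∈ (Finset.univ : Finset (Finset ι)).filter (fun V => ¬ (∑ i ∈ V, a i < t)), (∏ k, if k ∈ V then p k else 1 - p k) = 1 := by
    rw [Finset.sum_filter_add_sum_filter_not, sum_bernoulliWeight]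
  nlinarith [htr, htot]

/-- **MASS ROW (the far-relay row for block stars in the reliable regime from the mass alone).**  Gates `1/2 ≤ p₀ ≤ p i ≤ 1`, weights
`a i ≥ 0`, and a real `j` with `2j < ∑ a`.  Then `P(X ≤ j) ≤ 1 − p₀`.  For blobs of integer sizes this reads: least gate `x ≥ 1/2` and total
mass `≥ 2j + 1` imply `P(N ≥ j+1) ≥ x` — no hypothesis on the expected count.  (FALSE for `p₀ < 1/2`, and FALSE on trees even for least
marginal `≥ 1/2`: see the module docstring.) [this work] -/
theorem massRow (p a : ι → ℝ) (p₀ : ℝ) (hhalf : 1 / 2 ≤ p₀) (hp₀1 : p₀ ≤ 1)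
    (hp : ∀ i, p₀ ≤ p i) (hp1 : ∀ i, p i ≤ 1) (ha : ∀ i, 0 ≤ a i) (j : ℝ) (hj : 2 * j < ∑ i, a i) :
    ∑ W ∈ (Finset.univ : Finset (Finset ι)).filter (fun W => ∑ i ∈ W, a i ≤ j),
        (∏ k, if k ∈ W then p k else 1 - p k) ≤ 1 - p₀ := by
  have hp₀ : 0 ≤ p₀ := by linarith
  have hw0 : ∀ W, 0 ≤ (∏ k, if k ∈ W then p k else 1 - p k) := bernoulliWeight_nonneg (fun i => hp₀.trans (hp i)) hp1
  refine le_trans ?_ (halfMass_smallBall p a p₀ hhalf hp₀1 hp hp1 ha)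
  refine Finset.sum_le_sum_of_subset_of_nonneg (fun W hW => ?_) fun W _ _ => hw0 W
  rw [Finset.mem_filter] at hW ⊢
  exact ⟨hW.1, by linarith [hW.2]⟩

/-- **Mass row, conditioned form** (the shape of `far_indepBlob`): gates `1/2 ≤ p₀ ≤ p i ≤ 1`, `p₀ ≤ 1`, weights `a₀, a i ≥ 0`, and a
real `j` with `2j < a₀ + ∑ a`.  Then `p₀ · P(X + a₀ ≤ j) + (1 − p₀) · P(X ≤ j) ≤ 1 − p₀`, i.e. `P(a₀ε₀ + X ≤ j) ≤ 1 − p₀` after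
conditioning on the distinguished gate `ε₀` of law `p₀`. [this work] -/
theorem massRow_cond (p a : ι → ℝ) (p₀ a₀ : ℝ) (hhalf : 1 / 2 ≤ p₀) (hp₀1 : p₀ ≤ 1)
    (hp : ∀ i, p₀ ≤ p i) (hp1 : ∀ i, p i ≤ 1) (ha : ∀ i, 0 ≤ a i) (ha₀ : 0 ≤ a₀) (j : ℝ) (hj : 2 * j < a₀ + ∑ i, a i) :
    p₀ * (∑ W ∈ (Finset.univ : Finset (Finset ι)).filter (fun W => ∑ i ∈ W, a i + a₀ ≤ j), (∏ k, if k ∈ W then p k else 1 - p k)) +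
      (1 - p₀) * (∑ W ∈ (Finset.univ : Finset (Finset ι)).filter (fun W => ∑ i ∈ W, a i ≤ j), (∏ k, if k ∈ W then p k else 1 - p k)) ≤
        1 - p₀ := by
  have hp₀ : 0 ≤ p₀ := by linarith
  have hf0 : 0 ≤ 1 - p₀ := by linarith
  have hw0 : ∀ W, 0 ≤ (∏ k, if k ∈ W then p k else 1 - p k) := bernoulliWeight_nonneg (fun i => hp₀.trans (hp i)) hp1
  have hmain := halfMass_smallBall_cond p a p₀ a₀ hhalf hp₀1 hp hp1 ha ha₀
  have h1 : ∑ W ∈ (Finset.univ : Finset (Finset ι)).filter (fun W => ∑ i ∈ W, a i + a₀ ≤ j), (∏ k, if k ∈ W then p k else 1 - p k) ≤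
      ∑ W ∈ (Finset.univ : Finset (Finset ι)).filter
        (fun W => ∑ i ∈ W, a i + a₀ < (a₀ + ∑ i, a i) / 2), (∏ k, if k ∈ W then p k else 1 - p k) := by
    refine Finset.sum_le_sum_of_subset_of_nonneg (fun W hW => ?_) fun W _ _ => hw0 W
    rw [Finset.mem_filter] at hW ⊢
    exact ⟨hW.1, by linarith [hW.2]⟩
  have h2 : ∑ W ∈ (Finset.univ : Finset (Finset ι)).filter (fun W => ∑ i ∈ W, a i ≤ j), (∏ k, if k ∈ W then p k else 1 - p k) ≤
      ∑ W ∈ (Finset.univ : Finset (Finset ι)).filter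
        (fun W => ∑ i ∈ W, a i < (a₀ + ∑ i, a i) / 2), (∏ k, if k ∈ W then p k else 1 - p k) := by
    refine Finset.sum_le_sum_of_subset_of_nonneg (fun W hW => ?_) fun W _ _ => hw0 W
    rw [Finset.mem_filter] at hW ⊢
    exact ⟨hW.1, by linarith [hW.2]⟩
  have := add_le_add (mul_le_mul_of_nonneg_left h1 hp₀) (mul_le_mul_of_nonneg_left h2 hf0)
  exact this.trans hmain

end IndepBlob

end Quant

end Summit.CriticalPhenomena.PercolationContinuityZ3.Theorems
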